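import Mathlib.NumberTheory.SumPrimeReciprocals
import Literature.NumberTheory.EllipticCurves.DeligneSerreRankin
import Literature.NumberTheory.LFunctions.IdealNormCount
import HarnessLib

/-!
# Prime sums `∑_{p ∈ X} p^{-s}` near `s = 1` and the upper density of Deligne–Serre

Elementary lemmas (all proved) about the prime sums
`F_X(s) = ∑_{p ∈ X, p prime} p^{-s}` (`s > 1`) that enter the Dirichlet density
(Neukirch, *Algebraic Number Theory*, VII (13.1); Serre, *Cours d'arithmétique*, VI.4.1) and
Deligne–Serre's upper density `dens.sup X = limsup_{s → 1⁺} F_X(s) / log (1/(s-1))`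
(`Literature.NumberTheory.EllipticCurves.ModularForms.upperDensity`, Deligne–Serre 1974, (5.4.1)):

* `Literature.NumberTheory.LFunctions.PrimeSum.summable` — `F_X(s)` converges for `s > 1`;
* `Literature.NumberTheory.LFunctions.PrimeSum.tendsto_univ_div_log` — `F_{all primes}(s) / log (1/(s-1)) → 1` as `s → 1⁺`
  (from the tree's `Literature.NumberTheory.LFunctions.exists_tendsto_tsum_primes_rpow_add_log`, i.e.
  `∑_p p^{-s} = log (1/(s-1)) + O(1)`);
* `Literature.NumberTheory.LFunctions.PrimeSum.isBoundedUnder_div_log` — hence `F_X(s) / log (1/(s-1))` is bounded near `1⁺`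
  for every `X`, so that `upperDensity X` is a genuine `limsup`;
* `Literature.NumberTheory.LFunctions.PrimeSum.le_upperDensity_of_tendsto` — if `F_X(s)/log(1/(s-1)) → d` (i.e. `X` has
  Dirichlet density `d`) and all primes of `X` lie in `Y ∪ T` with `T` finite, then
  `d ≤ upperDensity Y`;
* `Literature.NumberTheory.LFunctions.PrimeSum.tendsto_div_log_zero_of_finite` — a finite set of primes has density `0`;
* `Literature.NumberTheory.LFunctions.PrimeSum.infinite_of_tendsto_pos` — a set of primes of positive density is infinite.

These are the bookkeeping steps of Deligne–Serre 1974, Lemme 8.3 (comparison of the Chebotarev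
density of a Frobenius condition with the upper density of the exceptional set `X_η` of
Prop. 5.5). The prime sums are written exactly as in `Literature.NumberTheory.EllipticCurves.ModularForms.upperDensity`, with the
decidability of `p ∈ X` taken as an instance argument so that the lemmas apply verbatim to the
classical `if`s of that definition.

## References

* P. Deligne, J.-P. Serre, *Formes modulaires de poids 1*, Ann. Sci. ÉNS (4) 7 (1974), (5.4.1),
  Lemme 8.3.
* J.-P. Serre, *Cours d'arithmétique*, PUF (1970), Ch. VI, §4.1.
-/

noncomputable section

open Filter Topology

namespace Literature.NumberTheory.LFunctions.PrimeSum

/-! ### Summability and elementary comparisons -/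

section Basic

variable (X : Set ℕ) [∀ p : ℕ, Decidable (p.Prime ∧ p ∈ X)]

/-- The general term of `F_X(s)` is non-negative. [folklore] -/
lemma term_nonneg (s : ℝ) (p : ℕ) :
    0 ≤ (if p.Prime ∧ p ∈ X then (p : ℝ) ^ (-s) else 0) := by
  split_ifs
  · positivity
  · exact le_rfl

/-- The general term of `F_X(s)` is at most `p^{-s}`. [folklore] -/
lemma term_le_rpow (s : ℝ) (p : ℕ) :
    (if p.Prime ∧ p ∈ X then (p : ℝ) ^ (-s) else 0) ≤ (p : ℝ) ^ (-s) := by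
  split_ifs
  · exact le_rfl
  · positivity

/-- The general term of `F_X(s)` is at most `1` for `s ≥ 0`. [folklore] -/
lemma term_le_one {s : ℝ} (hs : 0 ≤ s) (p : ℕ) :
    (if p.Prime ∧ p ∈ X then (p : ℝ) ^ (-s) else 0) ≤ 1 := by
  split_ifs with h
  · have hp1 : (1 : ℝ) ≤ p := by exact_mod_cast h.1.one_lt.le
    exact Real.rpow_le_one_of_one_le_of_nonpos hp1 (by linarith)
  · exact zero_le_one

/-- `F_X(s) = ∑_{p ∈ X} p^{-s}` converges for `s > 1`. [folklore] -/
theorem summable {s : ℝ} (hs : 1 < s) :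
    Summable fun p : ℕ ↦ if p.Prime ∧ p ∈ X then (p : ℝ) ^ (-s) else 0 := by
  have h : Summable fun p : ℕ ↦ (p : ℝ) ^ (-s) := Real.summable_nat_rpow.mpr (by linarith)
  exact h.of_nonneg_of_le (term_nonneg X s) (term_le_rpow X s)

/-- `F_X(s) ≥ 0`. [folklore] -/
lemma nonneg (s : ℝ) : 0 ≤ ∑' p : ℕ, (if p.Prime ∧ p ∈ X then (p : ℝ) ^ (-s) else 0) :=
  tsum_nonneg (term_nonneg X s)

/-- A finite set contributes at most its cardinality: `F_T(s) ≤ #T` for `s ≥ 0`. [folklore] -/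
theorem le_ncard_of_finite (hX : X.Finite) {s : ℝ} (hs : 0 ≤ s) :
    ∑' p : ℕ, (if p.Prime ∧ p ∈ X then (p : ℝ) ^ (-s) else 0) ≤ X.ncard := by
  have hzero : ∀ p ∉ hX.toFinset, (if p.Prime ∧ p ∈ X then (p : ℝ) ^ (-s) else 0) = 0 := by
    intro p hp
    rw [Set.Finite.mem_toFinset] at hp
    rw [if_neg (fun h ↦ hp h.2)]
  rw [tsum_eq_sum hzero, Set.ncard_eq_toFinset_card X hX]
  have h1 : ∑ p ∈ hX.toFinset, (if p.Prime ∧ p ∈ X then (p : ℝ) ^ (-s) else 0) ≤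
      ∑ p ∈ hX.toFinset, (1 : ℝ) :=
    Finset.sum_le_sum fun p _ ↦ term_le_one X hs p
  have h2 : ∑ p ∈ hX.toFinset, (1 : ℝ) = hX.toFinset.card := by
    rw [Finset.sum_const, nsmul_eq_mul, mul_one]
  linarith

variable {X} {Y : Set ℕ} [∀ p : ℕ, Decidable (p.Prime ∧ p ∈ Y)]

/-- Monotonicity: if every prime of `X` lies in `Y` then `F_X(s) ≤ F_Y(s)` (`s > 1`). [folklore] -/
theorem mono (h : ∀ p : ℕ, p.Prime → p ∈ X → p ∈ Y) {s : ℝ} (hs : 1 < s) :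
    ∑' p : ℕ, (if p.Prime ∧ p ∈ X then (p : ℝ) ^ (-s) else 0) ≤
      ∑' p : ℕ, (if p.Prime ∧ p ∈ Y then (p : ℝ) ^ (-s) else 0) := by
  refine Summable.tsum_le_tsum (fun p ↦ ?_) (summable X hs) (summable Y hs)
  by_cases hp : p.Prime ∧ p ∈ X
  · rw [if_pos hp, if_pos ⟨hp.1, h p hp.1 hp.2⟩]
  · rw [if_neg hp]
    exact term_nonneg Y s p

variable {Z : Set ℕ} [∀ p : ℕ, Decidable (p.Prime ∧ p ∈ Z)]

/-- Subadditivity: if every prime of `Z` lies in `X` or in `Y`, then `F_Z(s) ≤ F_X(s) + F_Y(s)`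
(`s > 1`). [folklore] -/
theorem le_add (h : ∀ p : ℕ, p.Prime → p ∈ Z → p ∈ X ∨ p ∈ Y) {s : ℝ} (hs : 1 < s) :
    ∑' p : ℕ, (if p.Prime ∧ p ∈ Z then (p : ℝ) ^ (-s) else 0) ≤
      ∑' p : ℕ, (if p.Prime ∧ p ∈ X then (p : ℝ) ^ (-s) else 0) +
        ∑' p : ℕ, (if p.Prime ∧ p ∈ Y then (p : ℝ) ^ (-s) else 0) := by
  rw [← (summable X hs).tsum_add (summable Y hs)]
  refine Summable.tsum_le_tsum (fun p ↦ ?_) (summable Z hs)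
    ((summable X hs).add (summable Y hs))
  have hXn := term_nonneg X s p
  have hYn := term_nonneg Y s p
  by_cases hp : p.Prime ∧ p ∈ Z
  · rw [if_pos hp]
    rcases h p hp.1 hp.2 with hX | hY
    · have : (if p.Prime ∧ p ∈ X then (p : ℝ) ^ (-s) else 0) = (p : ℝ) ^ (-s) :=
        if_pos ⟨hp.1, hX⟩
      linarith
    · have : (if p.Prime ∧ p ∈ Y then (p : ℝ) ^ (-s) else 0) = (p : ℝ) ^ (-s) :=
        if_pos ⟨hp.1, hY⟩
      linarith
  · rw [if_neg hp]
    linarith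

end Basic

/-- The sum over all primes: `F_ℕ(s) = ∑_{p prime} p^{-s}` as a sum over `Nat.Primes`. [folklore] -/
theorem univ_eq_tsum_primes (s : ℝ) :
    ∑' p : ℕ, (if p.Prime ∧ p ∈ (Set.univ : Set ℕ) then (p : ℝ) ^ (-s) else 0) =
      ∑' p : Nat.Primes, (p : ℝ) ^ (-s) := by
  change _ = ∑' p : (setOf Nat.Prime : Set ℕ), ((p : ℕ) : ℝ) ^ (-s)
  rw [tsum_subtype (setOf Nat.Prime) fun p : ℕ ↦ (p : ℝ) ^ (-s)]
  refine tsum_congr fun p ↦ ?_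
  simp only [Set.mem_univ, and_true, Set.indicator_apply, Set.mem_setOf_eq]

/-! ### Behaviour as `s → 1⁺` -/

/-- `log (1/(s-1)) → +∞` as `s → 1⁺`. [folklore] -/
theorem tendsto_log_one_div_sub_one :
    Tendsto (fun s : ℝ ↦ Real.log (1 / (s - 1))) (𝓝[>] (1 : ℝ)) atTop := by
  have h1 : Tendsto (fun s : ℝ ↦ s - 1) (𝓝[>] (1 : ℝ)) (𝓝[>] (0 : ℝ)) := by
    refine tendsto_nhdsWithin_of_tendsto_nhds_of_eventually_within _ ?_ ?_
    · have : Tendsto (fun s : ℝ ↦ s - 1) (𝓝 (1 : ℝ)) (𝓝 (1 - 1)) :=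
        tendsto_id.sub tendsto_const_nhds
      rw [sub_self] at this
      exact this.mono_left nhdsWithin_le_nhds
    · filter_upwards [self_mem_nhdsWithin] with s hs
      exact sub_pos.mpr (show (1 : ℝ) < s from hs)
  have h2 : Tendsto (fun s : ℝ ↦ (s - 1)⁻¹) (𝓝[>] (1 : ℝ)) atTop :=
    tendsto_inv_nhdsGT_zero.comp h1
  simpa only [one_div, Function.comp_def] using Real.tendsto_log_atTop.comp h2

/-- Eventually (as `s → 1⁺`) `log (1/(s-1)) > 0`. [folklore] -/
lemma eventually_log_pos : ∀ᶠ s : ℝ in 𝓝[>] (1 : ℝ), 0 < Real.log (1 / (s - 1)) :=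
  tendsto_log_one_div_sub_one.eventually_gt_atTop 0

/-- Eventually (as `s → 1⁺`) `1 < s`. [folklore] -/
lemma eventually_one_lt : ∀ᶠ s : ℝ in 𝓝[>] (1 : ℝ), 1 < s := self_mem_nhdsWithin

/-- **`∑_p p^{-s} ∼ log (1/(s-1))`**: `F_ℕ(s) / log (1/(s-1)) → 1` as `s → 1⁺`, from the tree's
`∑_p p^{-s} + log (s-1) → L` (`Literature.NumberTheory.LFunctions.exists_tendsto_tsum_primes_rpow_add_log`). [folklore] -/
theorem tendsto_univ_div_log :
    Tendsto (fun s : ℝ ↦ (∑' p : ℕ, (if p.Prime ∧ p ∈ (Set.univ : Set ℕ) then (p : ℝ) ^ (-s)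
      else 0)) / Real.log (1 / (s - 1))) (𝓝[>] (1 : ℝ)) (𝓝 1) := by
  obtain ⟨L, hL⟩ := Literature.NumberTheory.LFunctions.exists_tendsto_tsum_primes_rpow_add_log
  have hA : Tendsto (fun s : ℝ ↦ (∑' p : Nat.Primes, (p : ℝ) ^ (-s) + Real.log (s - 1)) /
      Real.log (1 / (s - 1))) (𝓝[>] (1 : ℝ)) (𝓝 0) := hL.div_atTop tendsto_log_one_div_sub_one
  have h := hA.add_const 1
  rw [zero_add] at h
  refine h.congr' ?_
  filter_upwards [eventually_log_pos] with s hs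
  rw [univ_eq_tsum_primes]
  have hM : Real.log (1 / (s - 1)) = -Real.log (s - 1) := by rw [one_div, Real.log_inv]
  rw [hM] at hs ⊢
  have hne : Real.log (s - 1) ≠ 0 := by intro h0; rw [h0, neg_zero] at hs; exact lt_irrefl _ hs
  field_simp
  ring

section Limits

variable (X : Set ℕ) [∀ p : ℕ, Decidable (p.Prime ∧ p ∈ X)]

/-- `F_X(s) / log (1/(s-1))` is bounded above near `s = 1⁺` (by `F_ℕ(s)/log(1/(s-1)) → 1`), so
that `upperDensity X` is a genuine `limsup`. [folklore] -/
theorem isBoundedUnder_div_log :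
    IsBoundedUnder (· ≤ ·) (𝓝[>] (1 : ℝ)) fun s : ℝ ↦
      (∑' p : ℕ, (if p.Prime ∧ p ∈ X then (p : ℝ) ^ (-s) else 0)) / Real.log (1 / (s - 1)) := by
  refine tendsto_univ_div_log.isBoundedUnder_le.mono_le ?_
  filter_upwards [eventually_log_pos, eventually_one_lt] with s hlog hs
  exact div_le_div_of_nonneg_right (mono (fun p _ _ ↦ Set.mem_univ p) hs) hlog.le

/-- `F_X(s) / log (1/(s-1)) ≥ 0` eventually. [folklore] -/
lemma eventually_div_log_nonneg :
    ∀ᶠ s : ℝ in 𝓝[>] (1 : ℝ),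
      0 ≤ (∑' p : ℕ, (if p.Prime ∧ p ∈ X then (p : ℝ) ^ (-s) else 0)) /
        Real.log (1 / (s - 1)) := by
  filter_upwards [eventually_log_pos] with s hlog
  exact div_nonneg (nonneg X s) hlog.le

/-- A finite set of primes is negligible: `F_T(s) / log (1/(s-1)) → 0` as `s → 1⁺`
(it is squeezed between `0` and `#T / log (1/(s-1))`). [folklore] -/
theorem tendsto_div_log_zero_of_finite (hX : X.Finite) :
    Tendsto (fun s : ℝ ↦ (∑' p : ℕ, (if p.Prime ∧ p ∈ X then (p : ℝ) ^ (-s) else 0)) /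
      Real.log (1 / (s - 1))) (𝓝[>] (1 : ℝ)) (𝓝 0) := by
  have hc : Tendsto (fun s : ℝ ↦ (X.ncard : ℝ) / Real.log (1 / (s - 1))) (𝓝[>] (1 : ℝ))
      (𝓝 0) := tendsto_const_nhds.div_atTop tendsto_log_one_div_sub_one
  refine tendsto_of_tendsto_of_tendsto_of_le_of_le' tendsto_const_nhds hc
    (eventually_div_log_nonneg X) ?_
  filter_upwards [eventually_log_pos, eventually_one_lt] with s hlog hs
  exact div_le_div_of_nonneg_right (le_ncard_of_finite X hX (by linarith)) hlog.le

variable {X}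

/-- **Comparison of a density with an upper density.** If `F_X(s) / log (1/(s-1)) → d` as
`s → 1⁺` (i.e. `X` has Dirichlet density `d`) and every prime of `X` lies in `Y ∪ T` with `T`
finite, then `d ≤ dens.sup Y` (`Literature.NumberTheory.EllipticCurves.ModularForms.upperDensity`, Deligne–Serre 1974, (5.4.1)).
This is the bookkeeping of op. cit. Lemme 8.3. [folklore] -/
theorem le_upperDensity_of_tendsto {Y T : Set ℕ} (hT : T.Finite)
    (hsub : ∀ p : ℕ, p.Prime → p ∈ X → p ∈ Y ∨ p ∈ T) {d : ℝ}
    (hd : Tendsto (fun s : ℝ ↦ (∑' p : ℕ, (if p.Prime ∧ p ∈ X then (p : ℝ) ^ (-s) else 0)) /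
      Real.log (1 / (s - 1))) (𝓝[>] (1 : ℝ)) (𝓝 d)) :
    d ≤ Literature.NumberTheory.EllipticCurves.ModularForms.upperDensity Y := by
  classical
  unfold Literature.NumberTheory.EllipticCurves.ModularForms.upperDensity
  refine le_of_forall_sub_le fun ε hε ↦ ?_
  refine le_limsup_of_frequently_le (Eventually.frequently ?_) (isBoundedUnder_div_log Y)
  have h1 : ∀ᶠ s : ℝ in 𝓝[>] (1 : ℝ), d - ε / 2 ≤
      (∑' p : ℕ, (if p.Prime ∧ p ∈ X then (p : ℝ) ^ (-s) else 0)) / Real.log (1 / (s - 1)) :=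
    hd.eventually (eventually_ge_nhds (by linarith))
  have h2 : ∀ᶠ s : ℝ in 𝓝[>] (1 : ℝ), (T.ncard : ℝ) / Real.log (1 / (s - 1)) ≤ ε / 2 := by
    have hc : Tendsto (fun s : ℝ ↦ (T.ncard : ℝ) / Real.log (1 / (s - 1))) (𝓝[>] (1 : ℝ))
        (𝓝 0) := tendsto_const_nhds.div_atTop tendsto_log_one_div_sub_one
    exact hc.eventually (eventually_le_nhds (by linarith))
  filter_upwards [h1, h2, eventually_log_pos, eventually_one_lt] with s h1 h2 hlog hs
  have hXle : ∑' p : ℕ, (if p.Prime ∧ p ∈ X then (p : ℝ) ^ (-s) else 0) ≤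
      ∑' p : ℕ, (if p.Prime ∧ p ∈ Y then (p : ℝ) ^ (-s) else 0) + T.ncard := by
    have hadd := le_add (Z := X) (X := Y) (Y := T) hsub hs
    have hTle := le_ncard_of_finite T hT (show (0 : ℝ) ≤ s by linarith)
    linarith
  have hdiv := div_le_div_of_nonneg_right hXle hlog.le
  rw [add_div] at hdiv
  linarith

/-- A set of primes of positive Dirichlet density is infinite. [folklore] -/
theorem infinite_of_tendsto_pos {d : ℝ} (hpos : 0 < d)
    (hd : Tendsto (fun s : ℝ ↦ (∑' p : ℕ, (if p.Prime ∧ p ∈ X then (p : ℝ) ^ (-s) else 0)) /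
      Real.log (1 / (s - 1))) (𝓝[>] (1 : ℝ)) (𝓝 d)) :
    {p : ℕ | p.Prime ∧ p ∈ X}.Infinite := by
  classical
  intro hfin
  have heq : ∀ s : ℝ, (∑' p : ℕ, (if p.Prime ∧ p ∈ X then (p : ℝ) ^ (-s) else 0)) =
      ∑' p : ℕ, (if p.Prime ∧ p ∈ {p : ℕ | p.Prime ∧ p ∈ X} then (p : ℝ) ^ (-s) else 0) := by
    intro s
    refine tsum_congr fun p ↦ ?_
    by_cases hp : p.Prime ∧ p ∈ X
    · rw [if_pos hp, if_pos ⟨hp.1, hp⟩]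
    · rw [if_neg hp, if_neg (fun h ↦ hp h.2)]
  have h0 := tendsto_div_log_zero_of_finite {p : ℕ | p.Prime ∧ p ∈ X} hfin
  simp only [← heq] at h0
  have := tendsto_nhds_unique hd h0
  linarith

/-- For every bound `B`, a set of primes of positive Dirichlet density contains a prime `p > B`.
[folklore] -/
theorem exists_gt_of_tendsto_pos {d : ℝ} (hpos : 0 < d)
    (hd : Tendsto (fun s : ℝ ↦ (∑' p : ℕ, (if p.Prime ∧ p ∈ X then (p : ℝ) ^ (-s) else 0)) /
      Real.log (1 / (s - 1))) (𝓝[>] (1 : ℝ)) (𝓝 d)) (B : ℕ) :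
    ∃ p : ℕ, p.Prime ∧ p ∈ X ∧ B < p := by
  have hinf := infinite_of_tendsto_pos hpos hd
  by_contra! h
  exact hinf (Set.Finite.subset (Set.finite_Iic B) fun p hp ↦ h p hp.1 hp.2)

end Limits

end Literature.NumberTheory.LFunctions.PrimeSum
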